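import Literature.Combinatorics.Designs.LegendrePairs.NineCompression333

/-!
# Legendre pairs of length 333: the full 9-compression identity and profile data

Shared infrastructure for the value-set 9-compression enumerations of [RamosHulakDeQueiroz2026, §4 Lemma 4 / Table 2]
(files `NineCompressionEnumRow8.lean`, `NineCompressionEnumRow6.lean`):
* the compression identity at `d = 9`, `Σ_{s ≡ t (9)} PAF_c(s) = Σ_r e_r e_{r+t}` for the 9-compression `e_r = cs 9 c r`
  (`paf_class9`; an instance of [DjokovicKotsireas2015, Thm 3]) and its values for a Legendre pair of length 333
  (`class_paf_sum`, `pair_facts`: row sums `±1`, `Σ_r e_r² + Σ_r f_r² = 594`, `Σ_r e_r e_{r+t} + Σ_r f_r f_{r+t} = −74` for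
  `t = 1, 2, 3, 4`), the bound `|e_r| ≤ 37` (`cs9_abs`) and the nine-class row sum (`rowsum_eq9`);
* profile data of a length-9 integer vector (`N9`, `P9`, `S9`, list form `L9`, `normsq`, `pl`) and the injective-enough
  profile key `key5` / `keyOf` / complement key `ckeyOf` used by both sieves, with the list/function conversion lemmas.

PROVENANCE.  Kernel-only, axiom-standard; pub-lottery cell (seat 1, 2026-08-19), packet files `NineCompEnum.lean` /
`NineCompEnum6.lean` §1–§3.  Definitions `χ`, `cs` from `NineCompression333.lean`.
-/

open Finset

set_option maxRecDepth 16384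

namespace Literature.Combinatorics.Designs.LegendrePairs

namespace NineComp333

/-! ### §1 bounds, the nine-class row sum, the compression identity at `d = 9` -/

/-- the nine class sums `e_r = cs 9 c r` of a `±1` sequence satisfy `|e_r| ≤ 37`. [folklore] -/
lemma cs9_abs (c : ZMod 333 → ℤ) (hc : IsPM c) (r : ℕ) (hr : r < 9) :
    cs 9 c r ≤ 37 ∧ -37 ≤ cs 9 c r := by
  have hχ : ∀ i, (0 : ℤ) ≤ χ 9 r i := fun i => by unfold χ; split_ifs <;> norm_num
  have up : cs 9 c r ≤ ∑ i, χ 9 r i := by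
    unfold cs
    refine Finset.sum_le_sum fun i _ => ?_
    rcases hc i with h | h <;> rw [h] <;> nlinarith [hχ i]
  have dn : -(∑ i, χ 9 r i) ≤ cs 9 c r := by
    unfold cs; rw [← Finset.sum_neg_distrib]
    refine Finset.sum_le_sum fun i _ => ?_
    rcases hc i with h | h <;> rw [h] <;> nlinarith [hχ i]
  rw [card_class9 r hr] at up dn
  exact ⟨up, by linarith⟩

/-- `Σ a` splits into the nine class sums [folklore] -/
lemma rowsum_eq9 (c : ZMod 333 → ℤ) : ∑ i, c i = ∑ r ∈ Finset.range 9, cs 9 c r := by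
  unfold cs
  rw [Finset.sum_comm]
  refine Finset.sum_congr rfl fun i _ => ?_
  rw [← Finset.sum_mul]
  have : ∑ r ∈ Finset.range 9, χ 9 r i = 1 := by
    unfold χ
    rw [Finset.sum_ite_eq]
    rw [if_pos (Finset.mem_range.mpr (Nat.mod_lt _ (by norm_num)))]
  rw [this, one_mul]

/-- orthogonality of the mod-9 class indicators against a shift: `Σ_r χ_r(i) χ_{r+t}(i+s) = χ_t(s)`. [folklore] -/
lemma delta9 (i s : ZMod 333) (t : ℕ) (ht : t < 9) :
    ∑ r ∈ Finset.range 9, χ 9 r i * χ 9 ((r + t) % 9) (i + s) = χ 9 t s := by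
  unfold χ
  simp_rw [ite_mul, one_mul, zero_mul]
  rw [Finset.sum_ite_eq, if_pos (Finset.mem_range.mpr (Nat.mod_lt _ (by norm_num)))]
  rw [val_add_mod (by decide : 9 ∣ 333)]
  have hx : i.val % 9 < 9 := Nat.mod_lt _ (by norm_num)
  have hy : s.val % 9 < 9 := Nat.mod_lt _ (by norm_num)
  by_cases h : s.val % 9 = t
  · rw [if_pos h, if_pos (by omega)]
  · rw [if_neg h, if_neg (by omega)]

/-- the compression identity at `d = 9`: `Σ_{s ≡ t (9)} PAF_c(s) = Σ_r e_r e_{r+t}` for the 9-compression `e = cs 9 c`. [cite: DjokovicKotsireas2015, Thm 3] -/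
lemma paf_class9 (c : ZMod 333 → ℤ) (t : ℕ) (ht : t < 9) :
    ∑ s, χ 9 t s * PAF c s = ∑ r ∈ Finset.range 9, cs 9 c r * cs 9 c ((r + t) % 9) := by
  have L : ∑ s, χ 9 t s * PAF c s = ∑ i, ∑ s, χ 9 t s * (c i * c (i + s)) := by
    unfold PAF
    simp_rw [Finset.mul_sum]
    rw [Finset.sum_comm]
  have R : ∑ r ∈ Finset.range 9, cs 9 c r * cs 9 c ((r + t) % 9)
      = ∑ i, ∑ s, χ 9 t s * (c i * c (i + s)) := by
    unfold cs
    simp_rw [Finset.sum_mul_sum]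
    rw [Finset.sum_comm]
    refine Finset.sum_congr rfl fun i _ => ?_
    rw [Finset.sum_comm]
    rw [← Equiv.sum_comp (Equiv.addLeft i)
      (fun j => ∑ r ∈ Finset.range 9, χ 9 r i * c i * (χ 9 ((r + t) % 9) j * c j))]
    refine Finset.sum_congr rfl fun s _ => ?_
    show ∑ r ∈ Finset.range 9, χ 9 r i * c i * (χ 9 ((r + t) % 9) (i + s) * c (i + s))
      = χ 9 t s * (c i * c (i + s))
    rw [← delta9 i s t ht, Finset.sum_mul]
    refine Finset.sum_congr rfl fun r _ => ?_
    ring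
  rw [L, R]

/-- for a Legendre pair of length 333, `Σ_{s ≡ t (9)} (PAF_a + PAF_b)(s)` equals `594` for `t = 0` and `−74` for `t ≠ 0`. [cite: RamosHulakDeQueiroz2026, §4 (norm / cross-sum conditions behind Lemma 4)] -/
lemma class_paf_sum (a b : ZMod 333 → ℤ) (h : LegendrePair a b) (t : ℕ) (ht : t < 9) :
    ∑ s, χ 9 t s * (PAF a s + PAF b s) = if t = 0 then 594 else -74 := by
  have key : ∀ s : ZMod 333, χ 9 t s * (PAF a s + PAF b s)
      = if s = 0 then (if t = 0 then 666 else 0) else if s.val % 9 = t then -2 else 0 := by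
    intro s
    by_cases hs : s = 0
    · subst hs
      rw [paf_zero a h.1, paf_zero b h.2.1, if_pos rfl]
      unfold χ
      rw [ZMod.val_zero, Nat.zero_mod]
      by_cases h0 : t = 0
      · rw [if_pos h0.symm, if_pos h0]; norm_num
      · rw [if_neg (fun h' => h0 h'.symm), if_neg h0]; norm_num
    · rw [if_neg hs, h.2.2 s hs]; unfold χ; split_ifs <;> simp
  rw [Finset.sum_congr rfl fun s _ => key s]
  interval_cases t <;> decide

/-- the five numerical consequences for the class sums `e = cs 9 a`, `f = cs 9 b` [cite: RamosHulakDeQueiroz2026, §4] -/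
lemma pair_facts (a b : ZMod 333 → ℤ) (h : LegendrePair a b) (t : ℕ) (ht : t < 9) :
    (∑ r ∈ Finset.range 9, cs 9 a r * cs 9 a ((r + t) % 9))
      + (∑ r ∈ Finset.range 9, cs 9 b r * cs 9 b ((r + t) % 9)) = if t = 0 then 594 else -74 := by
  rw [← paf_class9 a t ht, ← paf_class9 b t ht, ← Finset.sum_add_distrib, ← class_paf_sum a b h t ht]
  refine Finset.sum_congr rfl fun s _ => ?_
  ring

/-! ### §2 profile data of a length-9 vector and the profile keys -/

/-- data of a pair of candidate compression vectors, indexed by `ℕ` (positions `0..8`) [folklore] -/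
def N9 (e : ℕ → ℤ) : ℤ := ∑ r ∈ Finset.range 9, e r * e r
/-- periodic cross-sum `Σ_r e_r e_{r+t}` of a length-9 vector. [folklore] -/
def P9 (e : ℕ → ℤ) (t : ℕ) : ℤ := ∑ r ∈ Finset.range 9, e r * e ((r + t) % 9)
/-- row sum of a length-9 vector. [folklore] -/
def S9 (e : ℕ → ℤ) : ℤ := ∑ r ∈ Finset.range 9, e r
/-- the length-9 vector as a list. [folklore] -/
def L9 (e : ℕ → ℤ) : List ℤ := [e 0, e 1, e 2, e 3, e 4, e 5, e 6, e 7, e 8]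

/-- squared norm of an integer list. [folklore] -/
def normsq (l : List ℤ) : ℤ := (l.map fun x => x * x).sum
/-- periodic autocorrelation of a length-9 list at shift `t` [folklore] -/
def pl (l : List ℤ) (t : ℕ) : ℤ := ∑ r ∈ Finset.range 9, l.getD r 0 * l.getD ((r + t) % 9) 0
/-- injective packing of a profile `(norm, P1, P2, P3, P4)` (all entries in `[-600, 1447]`) into one integer [folklore] -/
def key5 (n p1 p2 p3 p4 : ℤ) : ℤ :=
  (((n * 2048 + (p1 + 600)) * 2048 + (p2 + 600)) * 2048 + (p3 + 600)) * 2048 + (p4 + 600)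
/-- the profile key (norm, four cross-sums) of a candidate list. [folklore] -/
def keyOf (l : List ℤ) : ℤ := key5 (normsq l) (pl l 1) (pl l 2) (pl l 3) (pl l 4)
/-- the key a COMPLEMENTARY partner of `l` would have [folklore] -/
def ckeyOf (l : List ℤ) : ℤ := key5 (594 - normsq l) (-74 - pl l 1) (-74 - pl l 2) (-74 - pl l 3) (-74 - pl l 4)

/-- `L9` recovers the entries. [folklore] -/
lemma getD9 (e : ℕ → ℤ) (r : ℕ) (hr : r < 9) : (L9 e).getD r 0 = e r := by
  unfold L9
  interval_cases r <;> rfl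

/-- the list cross-sum of `L9 e` is `P9 e`. [folklore] -/
lemma pl9 (e : ℕ → ℤ) (t : ℕ) : pl (L9 e) t = P9 e t := by
  unfold pl P9
  refine Finset.sum_congr rfl fun r hr => ?_
  rw [getD9 e r (Finset.mem_range.1 hr), getD9 e _ (Nat.mod_lt _ (by norm_num))]

/-- the list norm of `L9 e` is `N9 e`. [folklore] -/
lemma normsq9 (e : ℕ → ℤ) : normsq (L9 e) = N9 e := by
  simp only [normsq, L9, List.map, List.sum_cons, List.sum_nil, N9, Finset.sum_range_succ,
    Finset.sum_range_zero]
  ring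

/-- the list sum of `L9 e` is `S9 e`. [folklore] -/
lemma sum9 (e : ℕ → ℤ) : (L9 e).sum = S9 e := by
  simp only [L9, List.sum_cons, List.sum_nil, S9, Finset.sum_range_succ, Finset.sum_range_zero]
  ring

/-- `N9` is invariant under negation. [folklore] -/
lemma N9_neg (e : ℕ → ℤ) : N9 (fun r => -e r) = N9 e := by
  unfold N9; exact Finset.sum_congr rfl fun r _ => by ring
/-- `P9` is invariant under negation. [folklore] -/
lemma P9_neg (e : ℕ → ℤ) (t : ℕ) : P9 (fun r => -e r) t = P9 e t := by
  unfold P9; exact Finset.sum_congr rfl fun r _ => by ring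
/-- `S9` changes sign under negation. [folklore] -/
lemma S9_neg (e : ℕ → ℤ) : S9 (fun r => -e r) = -S9 e := by
  unfold S9; rw [Finset.sum_neg_distrib]

end NineComp333

end Literature.Combinatorics.Designs.LegendrePairs
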